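import Summits.ResolutionOfSingularities.ResolutionOfSingularities.Theorems.EquisingularLiftEquisingularLiftNatTowerVertexLevels
import Summits.ResolutionOfSingularities.ResolutionOfSingularities.Theorems.EquisingularLiftEquisingularLiftNatTowerVertices
import Summits.ResolutionOfSingularities.ResolutionOfSingularities.Theorems.EquisingularLiftEquisingularLiftNatD4VerticesAlgClosed
import HarnessLib

/-!
# [OURS] MIXED CONFIGURATIONS: a prime surface over `K̄` (`char ≠ 2, 3`) whose singular points are coordinate vertices of types «singular one-step»
# (level `0`), `D₄` = `y₀² + (y₁³ + y₂³)` (level `1`) and `A₅` = `y₀y₁ + y₂⁶` (level `2`), in any combination, satisfies `IsoHypPoint` — ONE consumer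
# (✓ `isoHypPoint_of_towerVertices`) for all the depth programme's vertex certificates
# (cruxes `Theses.EquisingularLift.EquisingularLiftNat` / `…NatThree` / `EquisingularLift`, stmt-ResolutionOfSingularities-20038 / -20148 / -15660)

[OURS · leafhand-res-equisingularlift-12 g0, 2026-08-31; cell `pub/decomp-res`] AI-produced, weaker than expert review; NOT a statement of any manuscript;
nothing here proves resolution of singularities in positive characteristic.  DEF-FREE helper; no `sorry`; standard axioms; ZERO named hypotheses.

* ★★★ `isoHypPoint_of_mixedVertices` — `K = K̄`, `2 ≠ 0`, `3 ≠ 0`; `F ∈ K[x₀,…,x₃]` a prime form; three lists of coordinate vertices: `S₀` with SINGULAR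
  one-step charts (`μ ≥ 2`, one-step datum, singular at most at the origin), `S₁` with chart `y₀² + (y₁³ + y₂³)`, `S₂` with chart `y₀y₁ + y₂⁶`; every other
  chart regular.  Then `IsoHypPoint K (1+2) V₊(F) ι` — levels `0 / 1 / 2` by ✓ `towerLevel_zero_vertex` / ✓ `towerLevel_one_vertex_D₄` /
  ✓ `towerLevel_two_vertex_A₅` in the tower of ✓ `exists_blowupTower`, consumed by ✓ `isoHypPoint_of_towerVertices`.

Honest label: closes no registered stub (certifies mixed `A₁/…/D₄/A₅`-vertex surfaces OUTSIDE the isolated residual's `¬ IsoHypPoint`).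

References: [Hartshorne1977, I Thm. 5.1, I Ex. 5.6, II Ex. 7.12]; [Lipman1969, §24]; [StacksProject, Tag 080E]; through the cited tree files.
-/

set_option linter.dupNamespace false -- mandated namespace `Summit.<Summit>.<Problem>` of this single-conjunct summit

noncomputable section

open CategoryTheory CategoryTheory.Limits AlgebraicGeometry TopologicalSpace
open Literature.AlgebraicGeometry.Resolution Literature.AlgebraicGeometry.Motives
open AlgebraicGeometry.Scheme.IdealSheafData
open MvPolynomial HomogeneousLocalization
open Literature.AlgebraicGeometry.Motives.SmoothHypersurface Literature.AlgebraicGeometry.Motives.ProjectiveSpace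
open Summit.ResolutionOfSingularities.ResolutionOfSingularities.Cruxes.EquisingularLift.StrataSplit

namespace Summit.ResolutionOfSingularities.ResolutionOfSingularities.Cruxes.EquisingularLiftNat.Sections

/-- ★★★ **MIXED SINGULAR ONE-STEP / `D₄` / `A₅` VERTICES ⟹ `IsoHypPoint`** (`K = K̄`, `char K ≠ 2, 3`). [OURS] [cite: Hartshorne1977, I Thm. 5.1, I Ex. 5.6]
[cite: StacksProject, Tag 080E] -/
theorem isoHypPoint_of_mixedVertices (K : Type) [Field K] [IsAlgClosed K] (h2 : (2 : K) ≠ 0) (h3 : (3 : K) ≠ 0)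
    (F : MvPolynomial (Fin (1 + 2 + 1)) K) {d : ℕ} (hF : F.IsHomogeneous d) (hFp : Prime F)
    (S₀ S₁ S₂ : List (Fin (1 + 2 + 1)))
    (hone : ∀ c ∈ S₀, ∃ (μ : ℕ) (Φ Ψ : MvPolynomial (Fin (1 + 2)) K), 2 ≤ μ ∧ Φ.IsHomogeneous μ ∧ Φ ≠ 0 ∧
      Ψ ∈ Ideal.span (Set.range (X : Fin (1 + 2) → MvPolynomial (Fin (1 + 2)) K)) ^ (μ + 1) ∧ ProjectiveSpace.dehomogenize K c F = Φ + Ψ ∧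
      ∀ l : Fin (1 + 2), ∃ G : MvPolynomial (Fin (1 + 2)) K,
        aeval (fun j => X l * Function.update (X : Fin (1 + 2) → MvPolynomial (Fin (1 + 2)) K) l 1 j) (Φ + Ψ) = X l ^ μ * G ∧
        ∀ P : Ideal (MvPolynomial (Fin (1 + 2)) K), P.IsPrime → (X l : MvPolynomial (Fin (1 + 2)) K) ∈ P → G ∈ P → ∃ j, pderiv j G ∉ P)
    (hsing₀ : ∀ c ∈ S₀, ∀ P : Ideal (MvPolynomial (Fin (1 + 2)) K), P.IsPrime → ProjectiveSpace.dehomogenize K c F ∈ P →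
      (∀ j, pderiv j (ProjectiveSpace.dehomogenize K c F) ∈ P) → ∀ j, (X j : MvPolynomial (Fin (1 + 2)) K) ∈ P)
    (hD₄ : ∀ c ∈ S₁, ProjectiveSpace.dehomogenize K c F = X 0 ^ 2 + (X 1 ^ 3 + X 2 ^ 3))
    (hA₅ : ∀ c ∈ S₂, ProjectiveSpace.dehomogenize K c F = X 0 * X 1 + X 2 ^ 6)
    (hoff : letI := MvPolynomial.gradedAlgebra (σ := Fin (1 + 2 + 1)) (R := K)
      ∀ c, c ∉ S₀ → c ∉ S₁ → c ∉ S₂ → IsRegularRing (ChartRing F c hF)) :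
    letI := MvPolynomial.gradedAlgebra (σ := Fin (1 + 2 + 1)) (R := K)
    IsoHypPoint K (1 + 2) (hypersurface F).left (hypersurfaceι F).left := by
  obtain ⟨D, hD0, hDsucc⟩ := exists_blowupTower
  obtain ⟨ζ, hζ, hfac⟩ := SecondOrderPoint.exists_split_X_cube_add_one K
  have hd : 0 < d := ConeN.pos_of_prime_of_isHomogeneous K F hF hFp
  have hΦA : (X 0 * X 1 : MvPolynomial (Fin 3) K).IsHomogeneous 2 := by
    simpa using (isHomogeneous_X K (0 : Fin 3)).mul (isHomogeneous_X K (1 : Fin 3))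
  have hΦD : (X 0 ^ 2 : MvPolynomial (Fin 3) K).IsHomogeneous 2 := isHomogeneous_X_pow (0 : Fin 3) 2
  have hmem : ∀ c, c ∈ S₀ ++ (S₁ ++ S₂) ↔ c ∈ S₀ ∨ c ∈ S₁ ∨ c ∈ S₂ := fun c => by simp [List.mem_append]
  refine isoHypPoint_of_towerVertices K D hD0 hDsucc F hF hFp (S₀ ++ (S₁ ++ S₂)) (fun c hc => ?_) (fun c hc => ?_)
    (fun c hc => hoff c (fun h => hc ((hmem c).mpr (Or.inl h))) (fun h => hc ((hmem c).mpr (Or.inr (Or.inl h))))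
      (fun h => hc ((hmem c).mpr (Or.inr (Or.inr h))))) (fun c hc => ?_)
  · -- the splits (multiplicity `≥ 2`)
    rcases (hmem c).mp hc with hc | hc | hc
    · obtain ⟨μ, Φ, Ψ, hμ, hΦ, -, hΨ, hdeh, -⟩ := hone c hc
      exact ⟨μ, Φ, Ψ, hμ, hΦ, hΨ, hdeh⟩
    · exact ⟨2, X 0 ^ 2, X 1 ^ 3 + X 2 ^ 3, le_rfl, hΦD, SecondOrderPoint.D₄_tail_mem_pow K, hD₄ c hc⟩
    · exact ⟨2, X 0 * X 1, X 2 ^ 6, le_rfl, hΦA, SecondOrderPoint.A₅_tail_mem_pow K, hA₅ c hc⟩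
  · -- singular at most at the origin
    rcases (hmem c).mp hc with hc | hc | hc
    · exact hsing₀ c hc
    · intro P hP hfP hdP j
      rw [hD₄ c hc] at hfP hdP
      exact SecondOrderPoint.D₄_singular_only_origin K h2 h3 P hP hfP hdP j
    · intro P hP hfP hdP j
      rw [hA₅ c hc] at hfP hdP
      exact SecondOrderPoint.A₅_singular_only_origin K P hP hfP hdP j
  · -- the levels
    rcases (hmem c).mp hc with hc | hc | hc
    · obtain ⟨μ, Φ, Ψ, hμ, hΦ, hΦ0, hΨ, hdeh, hG⟩ := hone c hc
      obtain ⟨x₀, -, hx₀X, hlev⟩ := towerLevel_zero_vertex K D hD0 hDsucc F hF hFp c Φ Ψ (by omega) hΦ hΦ0 hΨ hdeh hG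
      exact ⟨x₀, hx₀X, 0, hlev⟩
    · have hrad : (Ideal.span {(X 0 ^ 2 + (X 1 ^ 3 + X 2 ^ 3) : MvPolynomial (Fin 3) K)}).radical =
          Ideal.span {(X 0 ^ 2 + (X 1 ^ 3 + X 2 ^ 3) : MvPolynomial (Fin 3) K)} :=
        OrdPointAt.radical_span_dehomogenize_eq K F c hF hFp (X 0 ^ 2) (X 1 ^ 3 + X 2 ^ 3) hΦD (by norm_num)
          (SecondOrderPoint.D₄_tail_mem_pow K) (hD₄ c hc)
      obtain ⟨x₀, -, hx₀X, hlev⟩ := towerLevel_one_vertex_D₄ K D hD0 hDsucc F hF hd c h2 h3 ζ hζ hfac (hD₄ c hc) hrad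
      exact ⟨x₀, hx₀X, 1, hlev⟩
    · have hrad : (Ideal.span {(X 0 * X 1 + X 2 ^ 6 : MvPolynomial (Fin 3) K)}).radical =
          Ideal.span {(X 0 * X 1 + X 2 ^ 6 : MvPolynomial (Fin 3) K)} :=
        OrdPointAt.radical_span_dehomogenize_eq K F c hF hFp (X 0 * X 1) (X 2 ^ 6) hΦA (by norm_num) (SecondOrderPoint.A₅_tail_mem_pow K) (hA₅ c hc)
      obtain ⟨x₀, -, hx₀X, hlev⟩ := towerLevel_two_vertex_A₅ K D hD0 hDsucc F hF hd c (hA₅ c hc) hrad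
      exact ⟨x₀, hx₀X, 2, hlev⟩

end Summit.ResolutionOfSingularities.ResolutionOfSingularities.Cruxes.EquisingularLiftNat.Sections

end
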